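import Mathlib.Topology.MetricSpace.Pseudo.Defs
import Mathlib.LinearAlgebra.Trace
import Mathlib.LinearAlgebra.Determinant
import Literature.NumberTheory.GaloisRepresentations.CrystallineDeformationRing
import Literature.NumberTheory.GaloisRepresentations.LocalGaloisGroupFrobeniusProofs
import HarnessLib

/-!
# The locus of `2`-dimensional crystalline representations of `G_{ℚ_p}` with a given reduction
# is a standard subset of `ℚ̄_p` (Rozensztajn 2020, Theorem 1 / Theorem A, first half)

Trunk: GaloisRepresentations (cite item wi-10104, wanted by route WachCensus of the summit
`Langlands`, crux `SeedsOverQp2`: "every connected component `C` of Rozensztajn's standard subset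
`X(k, ρ̄)` …").

## Mathematics (S. Rozensztajn, *On the locus of 2-dimensional crystalline representations with
a given reduction modulo p*, Algebra & Number Theory 14 (2020); arXiv:1705.01060)

Fix a prime `p`, an integer `k ≥ 2` and a continuous `ρ̄ : G_{ℚ_p} → GL_2(𝔽)` over a finite
field `𝔽 ⊇ 𝔽_p` **with trivial endomorphisms** (so that Kisin's crystalline deformation ring
`R(k, ρ̄) = R^{ψ}(k, triv, ρ̄)`, `ψ = ε^{k-1}`, exists; it parametrises the crystalline lifts of
`ρ̄` with Hodge–Tate weights `(0, k-1)` and determinant `ε^{k-1}`; §5.1, Def. 5.1.2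
"deformation data", §5.4).  Crystalline `E`-representations `V` of `G_{ℚ_p}` of dimension `2`,
determinant `ε^{k-1}` and Hodge–Tate weights `(0, k-1)` carry the parameter
`a_p(V) := Tr(φ | D_cris(V^*))` (§5.4.1: `D_cris(V_{k,a_p}^*) = D_{k,a_p}`, `φ` of
characteristic polynomial `X² - a_p X + p^{k-1}`; Prop. 7.4.1: "`a_p` is the trace of `φ` on the
dual"; Lemma 5.4.1: `V ↦ a_p` is injective on isomorphism classes of irreducible, resp. reducible
non-split, such `V`), and `a_p` is a rigid-analytic function on the generic fibre
`𝒳(k, ρ̄)` of `R(k, ρ̄)`, injective on `ℚ̄_p`-points, with values in the closed unit disc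
(Thm. 5.3.1, Prop. 7.4.1).  Put

  `X(k, ρ̄) := a_p(𝒳(k, ρ̄)(ℚ̄_p)) = {a_p(ρ) : ρ a crystalline lift of ρ̄, HT weights (0,k-1), det ρ = ε^{k-1}} ⊆ ℚ̄_p`

(§5.3.1, notation after Cor. 5.3.2; §5.4).  A *rational disk* is `{x : |x - a| < r}` (open) or
`{x : |x - a| ≤ r}` (closed) with `a ∈ ℚ̄_p`, `r ∈ |ℚ̄_p^×|` (Def. 3.2.1); a *(bounded)
connected standard subset* of `ℚ̄_p` is `D₀ ∖ ⋃_{i=1}^n D_i` with `D₀` a rational OPEN disk, the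
`D_i ⊆ D₀` pairwise disjoint rational CLOSED disks, `D_i ≠ D₀` (Def. 3.3.1, first case); a
*standard subset* is a finite disjoint union of connected standard subsets, whose members are
its *connected components* (Def. 3.3.2; the decomposition is unique).  (Def. 3.3.1 also has
unbounded connected standard subsets `ℙ¹(ℚ̄_p) ∖ ⋃ D_i`; they contain `∞`, so a standard subset
of `ℙ¹(ℚ̄_p)` contained in `ℚ̄_p` — such as `X(k, ρ̄) ⊆ D(0,1)^+` — has bounded components only.)

**Theorem 1 (= Thm. A) of the Introduction, first half; Cor. 5.3.2 and Thm. 5.3.3 with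
`τ = triv`.** *`X(k, ρ̄)` is a standard subset of `ℚ̄_p`.*

## What this file provides

* `IsRationalRadius 𝕂 r`, `IsConnectedStandardSubset C`, `IsStandardSubset X`,
  `IsStandardComponentOf X C` — Def. 3.2.1, 3.3.1 (bounded case), 3.3.2 of [Roz20], for subsets
  of a normed field `𝕂` (intended `𝕂 = ℚ̄_p = PadicAlgCl p`, or `ℂ_p`), with the API lemmas
  `IsConnectedStandardSubset.isStandardSubset`, `isStandardSubset_empty`,
  `isConnectedStandardSubset_ball`, `IsStandardComponentOf.subset/isStandardSubset/…`.
* `HasTrivialEndomorphisms ρ̄` — the commutant of `ρ̄(G)` in `M_n` consists of scalars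
  ("`ρ̄` has trivial endomorphisms", Def. 5.1.2).
* `WeilDeligneRep.integralFrobTrace r Φ` and `PstWeilDeligneData.frobTraceParam 𝔇 ρ` — the
  parameter `a_p(ρ)` read off the Weil–Deligne representation `WD(ρ)` supplied by the `p`-adic
  Hodge datum `𝔇 : PstWeilDeligneData K p` of the tree (see "Conventions" below); PROVED
  (`frobTraceParam_eq_integralFrobTrace`): for unramified `WD(ρ)` the value does not depend on the
  choice of `WD(ρ)` in its isomorphism class nor on the geometric Frobenius.
* `PstWeilDeligneData.HasCrystallineHodgeType 𝔇 k ρ` — the Hodge condition "Hodge–Tate weights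
  `(0, k-1)` and `det ρ = ε^{k-1}`" on `ρ : G_K → GL_2(ℚ̄_p)`; it is the parameter `H` for which
  the accepted `CrystallineDeformationRing p K 𝒪 𝔽 ρ̄ 𝔇 H` is (the framed version of) Kisin's
  `R(k, ρ̄)`.
* `PstWeilDeligneData.crystallineLocus 𝔇 𝒪 k ρ̄` — **the set `X(k, ρ̄)`**, defined directly as the
  set of parameters of the `𝔇`-crystalline lifts `ρ : G_K → GL_2(𝒪_{ℚ̄_p})` of `ρ̄` (accepted
  `ReducesTo`) of Hodge type `(k)`; PROVED (`crystallineLocus_eq_range`): it is the image of the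
  `ℚ̄_p`-points of ANY crystalline deformation ring `𝓡 : CrystallineDeformationRing … ρ̄ 𝔇
  (𝔇.HasCrystallineHodgeType k)` under `x ↦ a_p(ρ_x)` — Rozensztajn's definition
  `X(k, ρ̄) = a_p(𝒳(k, ρ̄)(ℚ̄_p))` (the image does not see the framing).
* `PstWeilDeligneData.HasStandardCrystallineLoci 𝔇` — **Theorem 1 (first half) as a PREDICATE
  on the datum** (for `K` with `[K : ℚ_p] = 1`, i.e. `K = ℚ_p`): for every finite `L/ℚ_p`
  inside `ℚ̄_p`, every `k ≥ 2` and every continuous `ρ̄ : G_K → GL_2(k_L)` with trivial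
  endomorphisms, `X(k, ρ̄)` is a standard subset of `ℚ̄_p`.  Consumers holding a datum `𝔇`
  (e.g. `ReciprocityData.pst`) hypothesize `𝔇.HasStandardCrystallineLoci`, exactly as they
  hypothesize `𝔇.HasCrystallineDeformationRings`.
* Named fact (D-0014) `rozensztajn_crystallineLocus_isStandardSubset`: the genuine datum for
  `K = ℚ_p` (Fontaine's `B_dR`, `WD ∘ D_pst`) has this property, together with the properties
  recorded by the accepted `CrystallineDeformationRing.nonempty` — same shape as that fact.

## Conventions (faithfulness notes)

* **Hodge–Tate weights.** [Roz20] (like Kisin) normalises Hodge–Tate weights so that the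
  cyclotomic character `ε` has weight `+1` (`V_{k,a_p}`: weights `(0, k-1)`, `det = ε^{k-1}`;
  the filtration of the covariant `D_dR(V_{k,a_p})` jumps at `1-k` and `0`, cf. §7.5:
  `Fil^i Δ = 0` for `i ≤ 1-k`, `= Δ` for `i > 0`).  This tree's `PeriodRingData.hodgeTateWeights`
  records the jumps of the filtration on the covariant `D_dR(V)`, so that `ε` has weight `-1`
  (docstring of `hodgeTateWeights`; Buzzard–Gee, BLGGT).  Hence "Hodge–Tate weights `(0, k-1)`"
  of [Roz20] is `{1-k, 0}` here; `HasCrystallineHodgeType` says exactly this AND `det ρ = ε^{k-1}`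
  (a convention-free condition which pins the class in either normalisation).
* **The parameter `a_p`.** `a_p(V) = Tr(φ | D_cris(V^*)) = Tr(φ⁻¹ | D_cris(V))`.  The tree has no
  `D_cris` attached to `𝔇`; it has `WD(V)` (`𝔇.IsWeilDeligneOf`, intended `WD ∘ D_pst` of
  Fontaine, Exposé VIII: for crystalline `V` over `ℚ_p` the unramified representation on
  `D_cris(V)` on which a geometric Frobenius acts as `φ`, `N = 0`).  The two Frobenius elements
  `Φ^{±1}` of `W_{ℚ_p}` act on `WD(V)` with eigenvalues `{α⁻¹, β⁻¹}` and `{α, β}` respectively,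
  where `X² - a_p X + p^{k-1} = (X-α)(X-β)`; under the contravariant normalisation of `WD`
  (e.g. Clozel–Harris–Taylor) the roles are swapped.  We therefore normalise INTRINSICALLY
  (`integralFrobTrace`): take the trace of the one of `Φ`, `Φ⁻¹` whose determinant on `WD(V)` has
  norm `≤ 1`.  For `det V = ε^{k-1}`, `k ≥ 2`, the two determinants are `p^{∓(k-1)}`, exactly one
  has norm `≤ 1`, and the resulting trace is `α + β = a_p` under every one of these
  normalisations.  (For weight `k = 1`, not used here, both qualify and `Φ` is taken.)
* **`K = ℚ_p`.** The datum of the summit lives on completions `K = F_v`; the predicate asks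
  `[K : ℚ_p] = 1` (for the `ℚ_p`-algebra structure carried by `𝔇`), i.e. `K = ℚ_p` up to the
  unique isomorphism of valued fields — [Roz20] is about `G_{ℚ_p}` only ("our method … cannot be
  used beyond the case of 2-dimensional representations of `G_{ℚ_p}`", Introduction).
* **Coefficients of `ρ̄`.** As in the accepted `HasCrystallineDeformationRings`: `ρ̄` is valued in
  the residue field `k_L` of the integers `𝒪_L` of a finite `L/ℚ_p` inside `ℚ̄_p`, reduction of
  `𝒪_{ℚ̄_p}`-valued lifts is the accepted `ReducesTo 𝒪_L` (so `X(k, ρ̄)` depends only on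
  `ρ̄ ⊗ 𝔽̄_p`, as in [Roz20], where points of `R(k, ρ̄)` in finite extensions `E_x` are the lifts
  `G_{ℚ_p} → GL_2(𝒪_{E_x})` reducing to `ρ̄ ⊗ k_{E_x}`, §5.1).  The hypothesis
  `det ρ̄ = ω^{k-1}` of §5.4 is omitted: without it there is no lift of determinant `ε^{k-1}`,
  `X(k, ρ̄) = ∅` (`R^{ψ}(k, triv, ρ̄) = 0`, §5.4 first paragraph), and `∅` is a standard subset
  (`isStandardSubset_empty`), so the predicate says the same thing.

## Deliberately NOT here (not statable over the present tree; recorded for the planner)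

* Theorem 1, second half: `R(k, ρ̄)[1/p]` is the ring `𝒜_E(X(k, ρ̄))` of bounded rigid-analytic
  functions on `X(k, ρ̄)` (Cor. 5.3.2, §5.2, Prop. 5.3.5).  This concerns the UNFRAMED,
  fixed-determinant ring (`R^□ ≅ R(k, ρ̄)[[x₁, x₂, x₃]]`, on whose points `a_p` is not
  injective), whereas the accepted interface `CrystallineDeformationRing` is the framed ring of
  [BLGGT]; it also needs the rings `𝒜_F(X)` of Prop. 3.3.3.  Its consequence "points `x, y` of the
  framed ring lie on a common irreducible component of the geometric generic fibre iff `a_p(ρ_x)`,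
  `a_p(ρ_y)` lie in the same connected component of `X(k, ρ̄)`" (from Prop. 5.3.5, Lemma 3.3.6,
  Prop. 3.3.4) is what `SeedsOverQp2` alludes to; it is not printed as such and is not vendored.
* Theorem 2 (= Prop. 5.4.9, Thm. 5.3.3): `c_E(X(k, ρ̄)) ≤ e(R(k, ρ̄)/π_E) = μ_aut(k, ρ̄)` — needs
  the complexity `c_E` of §4 and the Breuil–Mézard multiplicity.
* Theorem 3 (= Thm. 5.4.11): `X(k, ρ̄)` is determined by finitely many reductions — its content is
  Cor. 4.5.2 over the class of standard subsets of bounded complexity; needs `c_E` and the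
  family `V_{k,a_p}` (definition item `crystallineRepOfWeaklyAdmissible`, open).

## References

* S. Rozensztajn, *On the locus of 2-dimensional crystalline representations with a given
  reduction modulo p*, Algebra Number Theory 14 (2020), no. 3, 643–700 (arXiv:1705.01060;
  theorem numbers below follow the arXiv version): Introduction Thm. 1 (= Thm. A); Def. 3.2.1,
  3.3.1, 3.3.2; Thm. 5.3.1, Cor. 5.3.2, Thm. 5.3.3, Prop. 5.3.5; §5.4, Lemma 5.4.1; Prop. 7.4.1.
  [Rozensztajn2020]
* M. Kisin, *Potentially semi-stable deformation rings*, J. Amer. Math. Soc. 21 (2008). [Kisin2007]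
* T. Barnet-Lamb, T. Gee, D. Geraghty, R. Taylor, *Potential automorphy and change of weight*,
  Ann. of Math. 179 (2014), §1.4. [BarnetlambEtAl2014]
* J.-M. Fontaine, *Représentations ℓ-adiques potentiellement semi-stables*, Astérisque 223
  (1994), Exposé VIII, §1.3, §2.3.7. [FontaineAsterisque223VIII]
-/

noncomputable section

open scoped MatrixGroups
open Field IsLocalRing

namespace Literature.NumberTheory.GaloisRepresentations

/-! ### Standard subsets of `ℚ̄_p` (Rozensztajn §3.2–3.3) -/

section Standard

variable (𝕂 : Type*) [NormedField 𝕂]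

/-- `r` is a **rational radius** for the normed field `𝕂`: `r ∈ |𝕂^×|`, i.e. `r = ‖t‖` for some
`t ≠ 0` (for `𝕂 = ℚ̄_p`: `r ∈ p^ℚ`).  Radii of *rational disks*, [Roz20] Def. 3.2.1.
[cite: Rozensztajn2020, Def. 3.2.1] -/
def IsRationalRadius (r : ℝ) : Prop :=
  ∃ t : 𝕂, t ≠ 0 ∧ ‖t‖ = r

variable {𝕂}

/-- A rational radius is positive. [folklore] -/
lemma IsRationalRadius.pos {r : ℝ} (h : IsRationalRadius 𝕂 r) : 0 < r := by
  obtain ⟨t, ht, rfl⟩ := h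
  exact norm_pos_iff.mpr ht

/-- `‖t‖` is a rational radius for `t ≠ 0`. [folklore] -/
lemma isRationalRadius_norm {t : 𝕂} (ht : t ≠ 0) : IsRationalRadius 𝕂 ‖t‖ :=
  ⟨t, ht, rfl⟩

/-- A **(bounded) connected standard subset** of `𝕂` ([Roz20] Def. 3.3.1, first case; intended
`𝕂 = ℚ̄_p`): a set of the form `D₀ ∖ ⋃_{i<m} D_i` where `D₀ = {x : ‖x - a₀‖ < r₀}` is a rational
OPEN disk (`Metric.ball`, `r₀ ∈ |𝕂^×|`), the `D_i = {x : ‖x - a_i‖ ≤ r_i}` (`i < m`, any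
`m ≥ 0`) are rational CLOSED disks (`Metric.closedBall`, `r_i ∈ |𝕂^×|`) contained in `D₀`,
different from `D₀`, and pairwise disjoint.  (The second case of Def. 3.3.1, unbounded
connected standard subsets `ℙ¹ ∖ ⋃ D_i` of `ℙ¹(ℚ̄_p)`, always contains `∞` and does not occur
for subsets of `ℚ̄_p`.) [cite: Rozensztajn2020, Def. 3.3.1] -/
def IsConnectedStandardSubset (C : Set 𝕂) : Prop :=
  ∃ (a₀ : 𝕂) (r₀ : ℝ) (m : ℕ) (a : Fin m → 𝕂) (r : Fin m → ℝ),
    IsRationalRadius 𝕂 r₀ ∧ (∀ i, IsRationalRadius 𝕂 (r i)) ∧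
      (∀ i, Metric.closedBall (a i) (r i) ⊆ Metric.ball a₀ r₀) ∧
      (∀ i, Metric.closedBall (a i) (r i) ≠ Metric.ball a₀ r₀) ∧
      (∀ i j, i ≠ j → Disjoint (Metric.closedBall (a i) (r i)) (Metric.closedBall (a j) (r j))) ∧
      C = Metric.ball a₀ r₀ \ ⋃ i, Metric.closedBall (a i) (r i)

/-- A **standard subset** of `𝕂` ([Roz20] Def. 3.3.2; intended `𝕂 = ℚ̄_p`): a finite disjoint
union of connected standard subsets (`IsConnectedStandardSubset`).  In the words of the
Introduction of [Roz20]: "a finite union of rational open disks from which we have removed a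
finite union of rational closed disks". [cite: Rozensztajn2020, Def. 3.3.2] -/
def IsStandardSubset (X : Set 𝕂) : Prop :=
  ∃ (m : ℕ) (C : Fin m → Set 𝕂), (∀ i, IsConnectedStandardSubset (C i)) ∧
    (∀ i j, i ≠ j → Disjoint (C i) (C j)) ∧ X = ⋃ i, C i

/-- `C` is a **connected component of the standard subset `X`** ([Roz20] Def. 3.3.2: "the
connected standard subsets that appear are called the connected components of the standard
subset"; the decomposition of a standard subset as a finite disjoint union of connected standard
subsets is unique, loc. cit.): `C` is a member of a decomposition of `X` as a finite disjoint
union of connected standard subsets. [cite: Rozensztajn2020, Def. 3.3.2] -/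
def IsStandardComponentOf (X C : Set 𝕂) : Prop :=
  ∃ (m : ℕ) (Cs : Fin m → Set 𝕂), (∀ i, IsConnectedStandardSubset (Cs i)) ∧
    (∀ i j, i ≠ j → Disjoint (Cs i) (Cs j)) ∧ X = ⋃ i, Cs i ∧ ∃ i, Cs i = C

/-- A rational open disk is a connected standard subset (no holes, `m = 0`). [cite: Rozensztajn2020, Def. 3.3.1] -/
lemma isConnectedStandardSubset_ball (a₀ : 𝕂) {r₀ : ℝ} (hr : IsRationalRadius 𝕂 r₀) :
    IsConnectedStandardSubset (Metric.ball a₀ r₀) := by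
  refine ⟨a₀, r₀, 0, Fin.elim0, Fin.elim0, hr, fun i => i.elim0, fun i => i.elim0,
    fun i => i.elim0, fun i => i.elim0, ?_⟩
  simp

/-- A connected standard subset is a standard subset (one-member decomposition). [cite: Rozensztajn2020, Def. 3.3.2] -/
lemma IsConnectedStandardSubset.isStandardSubset {C : Set 𝕂} (h : IsConnectedStandardSubset C) :
    IsStandardSubset C := by
  refine ⟨1, fun _ => C, fun _ => h, fun i j hij => ?_, ?_⟩
  · exact absurd (Subsingleton.elim i j) hij
  · ext x
    simp

/-- The empty set is a standard subset (the empty union; it is `X(k, ρ̄)` whenever `ρ̄` has no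
lift of the required type). [cite: Rozensztajn2020, Def. 3.3.2] -/
lemma isStandardSubset_empty : IsStandardSubset (∅ : Set 𝕂) :=
  ⟨0, Fin.elim0, fun i => i.elim0, fun i => i.elim0, by simp⟩

/-- A rational open disk is a standard subset. [cite: Rozensztajn2020, Def. 3.3.2] -/
lemma isStandardSubset_ball (a₀ : 𝕂) {r₀ : ℝ} (hr : IsRationalRadius 𝕂 r₀) :
    IsStandardSubset (Metric.ball a₀ r₀) :=
  (isConnectedStandardSubset_ball a₀ hr).isStandardSubset

/-- A set admitting a connected component in the sense of `IsStandardComponentOf` is a standard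
subset. [cite: Rozensztajn2020, Def. 3.3.2] -/
lemma IsStandardComponentOf.isStandardSubset {X C : Set 𝕂} (h : IsStandardComponentOf X C) :
    IsStandardSubset X := by
  obtain ⟨m, Cs, hCs, hdisj, hX, -⟩ := h
  exact ⟨m, Cs, hCs, hdisj, hX⟩

/-- A connected component of a standard subset is a connected standard subset. [cite: Rozensztajn2020, Def. 3.3.2] -/
lemma IsStandardComponentOf.isConnectedStandardSubset {X C : Set 𝕂}
    (h : IsStandardComponentOf X C) : IsConnectedStandardSubset C := by
  obtain ⟨m, Cs, hCs, -, -, i, rfl⟩ := h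
  exact hCs i

/-- A connected component of a standard subset is contained in it. [cite: Rozensztajn2020, Def. 3.3.2] -/
lemma IsStandardComponentOf.subset {X C : Set 𝕂} (h : IsStandardComponentOf X C) : C ⊆ X := by
  obtain ⟨m, Cs, -, -, rfl, i, rfl⟩ := h
  exact Set.subset_iUnion Cs i

/-- A connected standard subset is a connected component of itself. [cite: Rozensztajn2020, Def. 3.3.2] -/
lemma IsConnectedStandardSubset.isStandardComponentOf_self {C : Set 𝕂}
    (h : IsConnectedStandardSubset C) : IsStandardComponentOf C C := by
  refine ⟨1, fun _ => C, fun _ => h, fun i j hij => absurd (Subsingleton.elim i j) hij, ?_, 0, rfl⟩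
  ext x
  simp

/-- Every point of a standard subset lies in one of its connected components. [cite: Rozensztajn2020, Def. 3.3.2] -/
lemma IsStandardSubset.exists_isStandardComponentOf {X : Set 𝕂} (h : IsStandardSubset X) {x : 𝕂}
    (hx : x ∈ X) : ∃ C, IsStandardComponentOf X C ∧ x ∈ C := by
  obtain ⟨m, Cs, hCs, hdisj, rfl⟩ := h
  obtain ⟨i, hi⟩ := Set.mem_iUnion.mp hx
  exact ⟨Cs i, ⟨m, Cs, hCs, hdisj, rfl, i, rfl⟩, hi⟩

end Standard

/-! ### Representations with trivial endomorphisms -/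

section TrivialEnd

variable {G : Type*} [Group G] {A : Type*} [CommRing A] {n : ℕ}

/-- `ρ̄ : G → GL_n(A)` **has trivial endomorphisms**: every matrix commuting with all `ρ̄(g)` is a
scalar, i.e. `End_{A[G]}(ρ̄) = A` ([Roz20] Def. 5.1.2: "a continuous representation `ρ̄` … with
trivial endomorphisms", the hypothesis under which the deformation functor of `ρ̄` is
representable and Kisin's `R^ψ(k, τ, ρ̄)` is defined).  For a field `A` it holds for absolutely
irreducible `ρ̄` and for non-split extensions of two distinct characters. [cite: Rozensztajn2020, Def. 5.1.2] -/
def HasTrivialEndomorphisms (ρ : G →* GL (Fin n) A) : Prop :=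
  ∀ M : Matrix (Fin n) (Fin n) A,
    (∀ g : G, M * ((ρ g : GL (Fin n) A) : Matrix (Fin n) (Fin n) A) =
      ((ρ g : GL (Fin n) A) : Matrix (Fin n) (Fin n) A) * M) →
    ∃ c : A, M = Matrix.scalar (Fin n) c

/-- In rank `≤ 1` every representation has trivial endomorphisms (every `1 × 1` matrix is a
scalar; the `0 × 0` matrix is the scalar `0`). [folklore] -/
lemma hasTrivialEndomorphisms_of_subsingleton [Subsingleton (Fin n)] (ρ : G →* GL (Fin n) A) :
    HasTrivialEndomorphisms ρ := by
  intro M _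
  rcases Nat.eq_zero_or_pos n with hn | hn
  · subst hn
    exact ⟨0, Subsingleton.elim _ _⟩
  · haveI : Nonempty (Fin n) := ⟨⟨0, hn⟩⟩
    obtain ⟨i⟩ := ‹Nonempty (Fin n)›
    refine ⟨M i i, Matrix.ext fun a b => ?_⟩
    rw [Subsingleton.elim a i, Subsingleton.elim b i]
    simp

end TrivialEnd

/-! ### The parameter `a_p` of a crystalline representation, read off `WD(ρ)` -/

section Parameter

variable {K : Type} [Field K] [ValuativeRel K] [TopologicalSpace K] [IsNonarchimedeanLocalField K]
  {p : ℕ} [Fact p.Prime]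

/-- The **integrally normalised Frobenius trace** of a Weil–Deligne representation `r` over
`ℚ̄_p` at `Φ ∈ W_K`: `Tr r(Φ)` if `det r(Φ)` has norm `≤ 1`, and `Tr r(Φ⁻¹)` otherwise.  For
`r = WD(V)` with `V` crystalline of dimension `2`, determinant `ε^{k-1}` (`k ≥ 2`) and `Φ` a
Frobenius element, this is `α + β = a_p(V)` where `(X - α)(X - β) = X² - a_p X + p^{k-1}` is the
characteristic polynomial of `φ` on `D_cris(V^*)` ([Roz20] §5.4.1, Prop. 7.4.1), independently
of whether `WD` is normalised covariantly (geometric Frobenius acts on `D_cris(V)` as `φ`, with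
eigenvalues `α⁻¹, β⁻¹` and determinant `p^{1-k}` of norm `> 1`) or contravariantly (eigenvalues
`α, β`, determinant `p^{k-1}` of norm `< 1`); see the module docstring. [cite: Rozensztajn2020, §5.4.1 and Prop. 7.4.1] -/
def WeilDeligneRep.integralFrobTrace {V : Type*} [AddCommGroup V] [Module (PadicAlgCl p) V]
    (r : WeilDeligneRep K (PadicAlgCl p) V) (Φ : WeilGroup K) : PadicAlgCl p :=
  if ‖LinearMap.det (r.ρ Φ)‖ ≤ 1 then LinearMap.trace (PadicAlgCl p) V (r.ρ Φ)
  else LinearMap.trace (PadicAlgCl p) V (r.ρ Φ⁻¹)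

/-- Unfolding lemma: the integral branch. [folklore] -/
lemma WeilDeligneRep.integralFrobTrace_of_norm_le {V : Type*} [AddCommGroup V]
    [Module (PadicAlgCl p) V] (r : WeilDeligneRep K (PadicAlgCl p) V) {Φ : WeilGroup K}
    (h : ‖LinearMap.det (r.ρ Φ)‖ ≤ 1) :
    r.integralFrobTrace Φ = LinearMap.trace (PadicAlgCl p) V (r.ρ Φ) :=
  if_pos h

/-- Unfolding lemma: the non-integral branch. [folklore] -/
lemma WeilDeligneRep.integralFrobTrace_of_one_lt_norm {V : Type*} [AddCommGroup V]
    [Module (PadicAlgCl p) V] (r : WeilDeligneRep K (PadicAlgCl p) V) {Φ : WeilGroup K}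
    (h : 1 < ‖LinearMap.det (r.ρ Φ)‖) :
    r.integralFrobTrace Φ = LinearMap.trace (PadicAlgCl p) V (r.ρ Φ⁻¹) :=
  if_neg (not_le.mpr h)

/-- Isomorphic Weil–Deligne representations have the same integrally normalised Frobenius
traces (trace and determinant are similarity invariants). [folklore] -/
lemma WeilDeligneRep.integralFrobTrace_eq_of_equiv {V W : Type*} [AddCommGroup V]
    [Module (PadicAlgCl p) V] [AddCommGroup W] [Module (PadicAlgCl p) W]
    {r : WeilDeligneRep K (PadicAlgCl p) V} {r' : WeilDeligneRep K (PadicAlgCl p) W}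
    (e : r.Equiv r') (Φ : WeilGroup K) : r.integralFrobTrace Φ = r'.integralFrobTrace Φ := by
  have hconj : ∀ w, r'.ρ w = e.toRepEquiv.conj (r.ρ w) := fun w =>
    (Representation.Equiv.conj_apply_self w e.toRepEquiv).symm
  have hdet : LinearMap.det (r'.ρ Φ) = LinearMap.det (r.ρ Φ) := by
    rw [hconj, LinearEquiv.conj_apply, LinearMap.comp_assoc, LinearMap.det_conj]
  have htr : ∀ w, LinearMap.trace (PadicAlgCl p) W (r'.ρ w) =
      LinearMap.trace (PadicAlgCl p) V (r.ρ w) := fun w => by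
    rw [hconj, LinearMap.trace_conj']
  simp only [WeilDeligneRep.integralFrobTrace, hdet, htr]

/-- An unramified representation of `W_K` takes the same value on any two Frobenius powers of
the same exponent (they differ by an element of inertia: the proved
`IsFrobPow.mul_inv_mem_absInertia_holds`). [folklore] -/
lemma WeilGroup.IsUnramifiedRep.apply_eq_of_isFrobPow {C V : Type*} [CommSemiring C]
    [AddCommMonoid V] [Module C V] {π : Representation C (WeilGroup K) V}
    (h : WeilGroup.IsUnramifiedRep π) {Φ Φ' : WeilGroup K} {m : ℤ}
    (hΦ : IsFrobPow (WeilGroup.toAbsGalois K Φ) m) (hΦ' : IsFrobPow (WeilGroup.toAbsGalois K Φ') m) :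
    π Φ = π Φ' := by
  have hmem : Φ * Φ'⁻¹ ∈ WeilGroup.inertia K := by
    rw [WeilGroup.mem_inertia_iff, map_mul, map_inv]
    exact IsFrobPow.mul_inv_mem_absInertia_holds hΦ hΦ'
  have h1 : π (Φ * Φ'⁻¹) = 1 := h _ hmem
  calc π Φ = π (Φ * Φ'⁻¹ * Φ') := by rw [inv_mul_cancel_right]
    _ = π Φ' := by rw [map_mul, h1, one_mul]

/-- For a Weil–Deligne representation with unramified `ρ`, the integrally normalised Frobenius
trace is the same at all Frobenius powers of a given exponent. [folklore] -/
lemma WeilDeligneRep.integralFrobTrace_eq_of_isUnramifiedRep {V : Type*} [AddCommGroup V]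
    [Module (PadicAlgCl p) V] (r : WeilDeligneRep K (PadicAlgCl p) V)
    (hur : WeilGroup.IsUnramifiedRep r.ρ) {Φ Φ' : WeilGroup K} {m : ℤ}
    (hΦ : IsFrobPow (WeilGroup.toAbsGalois K Φ) m) (hΦ' : IsFrobPow (WeilGroup.toAbsGalois K Φ') m) :
    r.integralFrobTrace Φ = r.integralFrobTrace Φ' := by
  have h1 : r.ρ Φ = r.ρ Φ' := hur.apply_eq_of_isFrobPow hΦ hΦ'
  have h2 : r.ρ Φ⁻¹ = r.ρ Φ'⁻¹ :=
    hur.apply_eq_of_isFrobPow (m := -m) (by rw [map_inv]; exact hΦ.inv)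
      (by rw [map_inv]; exact hΦ'.inv)
  simp only [WeilDeligneRep.integralFrobTrace, h1, h2]

namespace PstWeilDeligneData

open Classical in
/-- **The parameter `a_p(ρ)`** of `ρ : Γ_K → GL_n(ℚ̄_p)` relative to the `p`-adic Hodge datum `𝔇`
(intended use: `K = ℚ_p`, `n = 2`, `ρ` crystalline): the integrally normalised trace
(`integralFrobTrace`) of a geometric Frobenius `Φ ∈ W_K` (accepted `WeilDeligneRep.geomFrob`,
Frobenius elements exist by the proved `exists_isFrobPow_holds`) on a Weil–Deligne
representation `r` attached to `ρ` by the datum (`𝔇.IsWeilDeligneOf ρ r`, intended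
`r ≅ WD(D_pst(ρ))`; one exists for de Rham `ρ`, `𝔇.exists_of_isDeRham`, and it is unique up to
isomorphism, `𝔇.isEquivalent`, so trace and determinant do not depend on the choice; for
crystalline `ρ` it is unramified, so they do not depend on `Φ` either).  For crystalline `ρ` of
dimension `2` with Hodge–Tate weights `(0, k-1)` and `det ρ = ε^{k-1}`, `k ≥ 2`, this is
Rozensztajn's `a_p(ρ) = Tr(φ | D_cris(ρ^*))` ([Roz20] §5.4.1; Prop. 7.4.1: "`a_p` … is the trace
of `φ` on the dual of `D`").  **Junk value** `0` when `ρ` has no attached Weil–Deligne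
representation (`ρ` not de Rham). [cite: Rozensztajn2020, §5.4.1 and Prop. 7.4.1] -/
def frobTraceParam (𝔇 : PstWeilDeligneData K p) {n : ℕ}
    (ρ : FramedRep (absoluteGaloisGroup K) (PadicAlgCl p) n) : PadicAlgCl p :=
  if h : ∃ r : WeilDeligneRep K (PadicAlgCl p) (Fin n → PadicAlgCl p), 𝔇.IsWeilDeligneOf ρ r then
    h.choose.integralFrobTrace (WeilDeligneRep.geomFrob K (exists_isFrobPow_holds K))
  else 0

/-- The junk branch of `frobTraceParam`. [folklore] -/
lemma frobTraceParam_of_not_exists (𝔇 : PstWeilDeligneData K p) {n : ℕ}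
    {ρ : FramedRep (absoluteGaloisGroup K) (PadicAlgCl p) n}
    (h : ¬ ∃ r : WeilDeligneRep K (PadicAlgCl p) (Fin n → PadicAlgCl p), 𝔇.IsWeilDeligneOf ρ r) :
    𝔇.frobTraceParam ρ = 0 := by
  classical
  exact dif_neg h

/-- **`frobTraceParam` does not depend on the choices made**: for any Weil–Deligne
representation `r` attached to `ρ` by the datum with `r.ρ` unramified (the case of crystalline
`ρ`, `IsCrystallineFramed`) and any geometric Frobenius `Φ ∈ W_K` (`deg Φ = -1`),
`a_p(ρ) = integralFrobTrace r Φ` — by uniqueness of `WD(ρ)` up to isomorphism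
(`𝔇.isEquivalent`) and triviality of `r.ρ` on inertia. [folklore] -/
theorem frobTraceParam_eq_integralFrobTrace (𝔇 : PstWeilDeligneData K p) {n : ℕ}
    {ρ : FramedRep (absoluteGaloisGroup K) (PadicAlgCl p) n}
    {r : WeilDeligneRep K (PadicAlgCl p) (Fin n → PadicAlgCl p)} (hr : 𝔇.IsWeilDeligneOf ρ r)
    (hur : WeilGroup.IsUnramifiedRep r.ρ) {Φ : WeilGroup K}
    (hΦ : IsFrobPow (WeilGroup.toAbsGalois K Φ) (-1)) :
    𝔇.frobTraceParam ρ = r.integralFrobTrace Φ := by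
  classical
  have hex : ∃ r' : WeilDeligneRep K (PadicAlgCl p) (Fin n → PadicAlgCl p),
      𝔇.IsWeilDeligneOf ρ r' := ⟨r, hr⟩
  rw [frobTraceParam, dif_pos hex]
  obtain ⟨e⟩ := 𝔇.isEquivalent ρ hex.choose r hex.choose_spec hr
  rw [WeilDeligneRep.integralFrobTrace_eq_of_equiv e]
  refine r.integralFrobTrace_eq_of_isUnramifiedRep hur ?_ hΦ
  rw [WeilDeligneRep.geomFrob, WeilGroup.toAbsGalois_mk]
  exact Classical.choose_spec (exists_isFrobPow_holds K (-1))

/-! ### The Hodge type "weights `(0, k-1)`, determinant `ε^{k-1}`" and the locus `X(k, ρ̄)` -/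

/-- **`ρ : Γ_K → GL_2(ℚ̄_p)` has the crystalline Hodge type of weight `k`** relative to `𝔇`:
(i) some finite model `rE` of `ρ` (accepted `HasQlModel`, `restrictScalarsQl`) is de Rham for
`𝔇.𝔅` with SET of Hodge–Tate weights (accepted `PeriodRingData.hodgeTateWeights`, the multiset of
the `ℚ_p`-linear model, in which each weight is repeated `[E : ℚ_p]` times) equal to `{1-k, 0}` —
this is "Hodge–Tate weights `(0, k-1)`" of [Roz20]/Kisin in this tree's sign convention
(cyclotomic character ↦ `-1`; module docstring) — and (ii) `det ρ = ε^{k-1}`, `ε` the `p`-adic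
cyclotomic character (accepted `GaloisRep.cyclotomicCharacter`).  Together with
`𝔇.IsCrystallineFramed` this is the condition cut out by Kisin's `R(k, ρ̄) = R^{ε^{k-1}}(k, triv, ρ̄)`
([Roz20] §5.4: "crystalline lifts of `ρ̄` with determinant `ε^{k-1}` and Hodge–Tate weights `0`
and `k-1`"); accordingly `CrystallineDeformationRing p K 𝒪 𝔽 ρ̄ 𝔇 (𝔇.HasCrystallineHodgeType k)`
is the framed, fixed-determinant variant `R^{□,ψ}(k, ρ̄)` (`ψ = ε^{k-1}`) of that ring (for `ρ̄`
with trivial endomorphisms `R^{□,ψ}(k, ρ̄) ≅ R(k, ρ̄)[[x₁, x₂, x₃]]`, the framing being formally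
smooth of relative dimension `3`).  `ℕ`-subtraction `k - 1` is harmless: `k ≥ 2` in every use.
[cite: Rozensztajn2020, §5.4] [cite: Kisin2007, Introduction] -/
def HasCrystallineHodgeType (𝔇 : PstWeilDeligneData K p) (k : ℕ)
    (ρ : FramedRep (absoluteGaloisGroup K) (PadicAlgCl p) 2) : Prop :=
  (∃ (E : IntermediateField ℚ_[p] (PadicAlgCl p)) (_ : FiniteDimensional ℚ_[p] E)
      (rE : FramedRep (absoluteGaloisGroup K) E 2),
      Literature.NumberTheory.Automorphic.HasQlModel ρ E rE ∧
        letI := 𝔇.algebra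
        (Literature.NumberTheory.Automorphic.restrictScalarsQl E rE).IsDeRham 𝔇.𝔅 ∧
          (𝔇.𝔅.hodgeTateWeights (Literature.NumberTheory.Automorphic.restrictScalarsQl E rE)).toFinset
            = {1 - (k : ℤ), 0}) ∧
    ∀ γ : absoluteGaloisGroup K,
      ((FramedRep.det ρ γ : (PadicAlgCl p)ˣ) : PadicAlgCl p) =
        algebraMap ℚ_[p] (PadicAlgCl p)
          (((GaloisRep.cyclotomicCharacter K p γ : ℤ_[p]ˣ) : ℤ_[p]) : ℚ_[p]) ^ (k - 1)

section Locus

variable (𝔇 : PstWeilDeligneData K p) (O : Type) [CommRing O] [Algebra O (PadicAlgCl p)]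
  {kk : Type} [Field kk] [Algebra O kk]

/-- **Rozensztajn's locus `X(k, ρ̄) ⊆ ℚ̄_p`** ([Roz20] §5.3.1, §5.4: the image of the
`ℚ̄_p`-points of the crystalline deformation space `𝒳(k, ρ̄)` under the parameter `a_p`),
relative to the datum `𝔇` and the coefficient maps `𝒪 → ℚ̄_p`, `𝒪 → 𝔽` (intended `𝒪 = 𝒪_L`,
`𝔽 = k_L`): the set of parameters `a_p(ρ)` (`frobTraceParam`) of the continuous
`ρ : Γ_K → GL_2(𝒪_{ℚ̄_p})` reducing to `ρ̄` (accepted `ReducesTo`) which are `𝔇`-crystalline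
(accepted `IsCrystallineFramed`) of Hodge type `(k)` (`HasCrystallineHodgeType`: weights
`(0, k-1)`, `det = ε^{k-1}`).  Equal to the image of the points of any crystalline deformation
ring of `ρ̄` of that Hodge type (`crystallineLocus_eq_range`).  Loosely (Introduction of
[Roz20]) "the set of `a_p` such that `V̄_{k,a_p}^{ss} = ρ̄^{ss}`"; precisely that set is
`Y(k, ρ̄^{ss})` of §5.4.3, which agrees with `X(k, ρ̄) ∩ D(0,1)⁻` for *nice* `ρ̄` (Prop. 5.4.3).
[cite: Rozensztajn2020, §5.3.1 and §5.4] -/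
def crystallineLocus (k : ℕ) (ρbar : absoluteGaloisGroup K →* GL (Fin 2) kk) :
    Set (PadicAlgCl p) :=
  {a | ∃ ρ : FramedRep (absoluteGaloisGroup K) (PadicAlgCl p) 2,
    ReducesTo O ρ.toMonoidHom ρbar ∧ 𝔇.IsCrystallineFramed ρ ∧ 𝔇.HasCrystallineHodgeType k ρ ∧
      𝔇.frobTraceParam ρ = a}

variable {𝔇 O}

/-- Membership in `X(k, ρ̄)`, unfolded. [folklore] -/
lemma mem_crystallineLocus_iff {k : ℕ} {ρbar : absoluteGaloisGroup K →* GL (Fin 2) kk}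
    {a : PadicAlgCl p} :
    a ∈ 𝔇.crystallineLocus O k ρbar ↔ ∃ ρ : FramedRep (absoluteGaloisGroup K) (PadicAlgCl p) 2,
      ReducesTo O ρ.toMonoidHom ρbar ∧ 𝔇.IsCrystallineFramed ρ ∧ 𝔇.HasCrystallineHodgeType k ρ ∧
        𝔇.frobTraceParam ρ = a :=
  Iff.rfl

/-- The parameter of a crystalline lift of Hodge type `(k)` lies in `X(k, ρ̄)`. [folklore] -/
lemma frobTraceParam_mem_crystallineLocus {k : ℕ} {ρbar : absoluteGaloisGroup K →* GL (Fin 2) kk}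
    {ρ : FramedRep (absoluteGaloisGroup K) (PadicAlgCl p) 2} (hred : ReducesTo O ρ.toMonoidHom ρbar)
    (hcr : 𝔇.IsCrystallineFramed ρ) (hH : 𝔇.HasCrystallineHodgeType k ρ) :
    𝔇.frobTraceParam ρ ∈ 𝔇.crystallineLocus O k ρbar :=
  ⟨ρ, hred, hcr, hH, rfl⟩

/-- **`X(k, ρ̄)` is the image of the `ℚ̄_p`-points of the crystalline deformation ring under
`x ↦ a_p(ρ_x)`** — Rozensztajn's definition `X(k, ρ̄) = a_p(𝒳(k, ρ̄)(ℚ̄_p))` ([Roz20] §5.3.1),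
for ANY `𝓡 : CrystallineDeformationRing p K 𝒪 𝔽 ρ̄ 𝔇 (𝔇.HasCrystallineHodgeType k)` (the accepted
framed interface; the image does not see the framing): by the characterising bijection
`𝓡.pointEquiv` between points and crystalline lifts of Hodge type `(k)`. [cite: Rozensztajn2020, §5.3.1] -/
theorem crystallineLocus_eq_range [TopologicalSpace kk] {k : ℕ}
    {ρbar : FramedRep (absoluteGaloisGroup K) kk 2}
    (𝓡 : CrystallineDeformationRing p K O kk ρbar 𝔇 (𝔇.HasCrystallineHodgeType k)) :
    𝔇.crystallineLocus O k ρbar.toMonoidHom =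
      Set.range fun x : 𝓡.R →ₐ[O] PadicAlgCl p => 𝔇.frobTraceParam (𝓡.liftAt x) := by
  ext a
  constructor
  · rintro ⟨ρ, hred, hcr, hH, rfl⟩
    refine ⟨𝓡.pointOf ρ hred ⟨hcr, hH⟩, ?_⟩
    simp only [PointwiseLiftingRing.liftAt_pointOf]
  · rintro ⟨x, rfl⟩
    exact ⟨𝓡.liftAt x, 𝓡.reducesTo_liftAt x, 𝓡.isCrystallineFramed_liftAt x,
      𝓡.hodgeType_liftAt x, rfl⟩

/-- In particular all points of a crystalline deformation ring of Hodge type `(k)` have their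
parameter in `X(k, ρ̄)`. [cite: Rozensztajn2020, §5.3.1] -/
lemma frobTraceParam_liftAt_mem [TopologicalSpace kk] {k : ℕ}
    {ρbar : FramedRep (absoluteGaloisGroup K) kk 2}
    (𝓡 : CrystallineDeformationRing p K O kk ρbar 𝔇 (𝔇.HasCrystallineHodgeType k))
    (x : 𝓡.R →ₐ[O] PadicAlgCl p) :
    𝔇.frobTraceParam (𝓡.liftAt x) ∈ 𝔇.crystallineLocus O k ρbar.toMonoidHom := by
  rw [crystallineLocus_eq_range 𝓡]
  exact ⟨x, rfl⟩

end Locus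

/-! ### Theorem 1 of [Roz20], first half, as a predicate on the datum; the named fact -/

/-- **Rozensztajn's Theorem 1 (first half) for the datum `𝔇`** (a PREDICATE on
`𝔇 : PstWeilDeligneData K p`, in the manner of the accepted `HasCrystallineDeformationRings`):
if `K = ℚ_p` (degree `[K : ℚ_p] = 1` for the `ℚ_p`-algebra structure `𝔇.algebra`), then for
every finite `L/ℚ_p` inside `ℚ̄_p` with integers `𝒪_L` and residue field `k_L` (discrete), every
integer `k ≥ 2` and every continuous `ρ̄ : Γ_K → GL_2(k_L)` with trivial endomorphisms
(`HasTrivialEndomorphisms`; [Roz20] Def. 5.1.2, deformation data `(k, triv, ρ̄, ε^{k-1})`), the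
locus `X(k, ρ̄) ⊆ ℚ̄_p` (`crystallineLocus`) of parameters `a_p` of the crystalline lifts of `ρ̄`
with Hodge–Tate weights `(0, k-1)` and determinant `ε^{k-1}` **is a standard subset of `ℚ̄_p`**
(`IsStandardSubset`: a finite disjoint union of rational open disks with finitely many rational
closed disks removed).  [Roz20], Introduction, Theorem 1 (= Theorem A), first assertion; proved
as Cor. 5.3.2 / Thm. 5.3.3 (for all deformation data; here `τ = triv`, §5.4) from Thm. 5.3.1
(the parameter is an injective analytic function on the generic fibre of Kisin's `R(k, ρ̄)`) and
Thm. 3.4.1.  The second assertion of Theorem 1 (`R(k, ρ̄)[1/p]` is the ring of bounded analytic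
functions on `X(k, ρ̄)`) is not recorded (module docstring). [cite: Rozensztajn2020, Introduction Thm. 1 and Cor. 5.3.2] -/
def HasStandardCrystallineLoci (𝔇 : PstWeilDeligneData K p) : Prop :=
  (letI := 𝔇.algebra; Module.finrank ℚ_[p] K = 1) →
    ∀ (L : IntermediateField ℚ_[p] (PadicAlgCl p)) [FiniteDimensional ℚ_[p] L] (k : ℕ), 2 ≤ k →
      letI := intermediateFieldIntegers.algebraPadicAlgCl L
      letI : TopologicalSpace (ResidueField (intermediateFieldIntegers p L)) := ⊥
      ∀ ρbar : FramedRep (absoluteGaloisGroup K) (ResidueField (intermediateFieldIntegers p L)) 2,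
        HasTrivialEndomorphisms ρbar.toMonoidHom →
          IsStandardSubset (𝔇.crystallineLocus (intermediateFieldIntegers p L) k ρbar.toMonoidHom)

end PstWeilDeligneData

end Parameter

/-- **Rozensztajn 2020, Theorem 1 (first half), for the genuine `p`-adic Hodge datum of `ℚ_p`.**
For every prime `p` and every non-archimedean local field `K` of characteristic zero given with a
`ℚ_p`-algebra structure of degree `[K : ℚ_p] = 1` (i.e. `K = ℚ_p`), there is a `p`-adic Hodge
datum `𝔇 : PstWeilDeligneData K p` with that algebra structure — INTENDED: Fontaine's `B_dR(K)` and
`WD ∘ D_pst`, as in the accepted `PstWeilDeligneData.nonempty` and `CrystallineDeformationRing.nonempty`,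
whose properties `UnramifiedWeightsZero` (Fontaine, Exposé III §5) and
`HasCrystallineDeformationRings` (Kisin 2008) are repeated here so that one datum carries all of
them — such that moreover `𝔇.HasStandardCrystallineLoci`: for every `k ≥ 2` and every continuous
`ρ̄ : G_{ℚ_p} → GL_2(k_L)` with trivial endomorphisms, the locus `X(k, ρ̄)` of parameters `a_p`
of the crystalline lifts of `ρ̄` with Hodge–Tate weights `(0, k-1)` and determinant `ε^{k-1}` is a
standard subset of `ℚ̄_p` ([Roz20], Introduction, Theorem 1 = Theorem A, first assertion;
Cor. 5.3.2, Thm. 5.3.3).  Named fact (D-0014); consumers holding a datum hypothesize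
`𝔇.HasStandardCrystallineLoci` directly. [cite: Rozensztajn2020, Introduction Thm. 1 and Cor. 5.3.2] [cite: Kisin2007, Introduction, Thm. 2.5.5 and Cor. 2.7.7] [cite: FontaineAsterisque223III, §5] -/
def rozensztajn_crystallineLocus_isStandardSubset : Prop :=
  ∀ (K : Type) [Field K] [ValuativeRel K] [TopologicalSpace K] [IsNonarchimedeanLocalField K]
    (p : ℕ) [Fact p.Prime] [CharZero K] (alg : Algebra ℚ_[p] K), Module.finrank ℚ_[p] K = 1 →
    ∃ 𝔇 : PstWeilDeligneData K p, 𝔇.algebra = alg ∧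
      𝔇.UnramifiedWeightsZero ∧ 𝔇.HasCrystallineDeformationRings ∧ 𝔇.HasStandardCrystallineLoci

end Literature.NumberTheory.GaloisRepresentations

end
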